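import Literature.MathematicalPhysics.PowerSystems.NonMinimumEquilibriumInstability
import HarnessLib

/-!
# First-order tier (lossless non-uniform Kuramoto model / droop-controlled inverter network): a
# synchronized state at which the potential is NOT a local minimum is an UNSTABLE synchronized
# solution (energy route); on a radial network every synchronized state with a negative-cosine edge
# is unstable — «one is stable and 2ᴺ⁻¹ − 1 are unstable» (Manik–Timme–Witthaut 2017 Cor. 2; their
# Lemma 1 «for both Kuramoto system and the power grid model»), for the first-order motions

Topic `Literature/MathematicalPhysics/PowerSystems`, namespace
`Literature.MathematicalPhysics.PowerSystems.NonuniformKuramoto` (lit-2's record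
`NonuniformKuramotoPhaseCohesiveness.lean`: data `NonuniformKuramoto n` = `D, ω, P, φ`, the field
`θ̇ᵢ = (ωᵢ − Σⱼ Pᵢⱼ sin(θᵢ − θⱼ + φᵢⱼ))/Dᵢ`; the global-behaviour theorems of
`NonuniformKuramotoDichotomy.lean` (lossless case `φ = 0`: gradient flow `Dθ̇ = −∇U(θ)`,
`U(θ) = −Σ ωᵢθᵢ − ½ΣΣ Pᵢⱼcos(θᵢ − θⱼ)`); the census lemmas of `FiniteEquilibriumSetIsolation.lean`;
the radial statics of `AcyclicSynchronizationCondition.lean` / `UnicyclicNetworkEquilibria.lean`; the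
second-order twins `NonMinimumEquilibriumInstability.lean` / `StructurePreservingNonMinimumInstability.lean`
— all used unchanged). Everything below is PROVED (no definition, no named fact, no new axiom).

SOURCES (read on the page this session): D. Manik, M. Timme, D. Witthaut, Chaos 27 (2017) 083123
[ManikTimmeWitthaut2017] (arXiv:1611.09825, chunks p0004, p0010–p0011): §2 «Both the Kuramoto
system and the oscillator model of power grids share the same set of fixed points … the linear
stability properties of those fixed points are identical»; the potential `V(θ)` and its Hesse matrix
`M(θ*)`; **Lemma 1** («… transversally asymptotically stable for both Kuramoto system and the power
grid model system. If one of the μ_k < 0, then the dynamical system is linearly unstable»);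
**Cor. 2** (tree: «one is stable and 2^{N−1} − 1 are unstable») with its proof (test vector across a
negative-cosine edge). J. W. Simpson-Porco, F. Dörfler, F. Bullo, *Synchronization and power sharing
for droop-controlled inverters in islanded microgrids*, Automatica 49 (2013) [SimpsonporcoDorflerBullo2013]
(arXiv:1206.5033 chunk p0007): §3 Lemma 1 (droop-controlled inverters = non-uniform Kuramoto,
`Pᵢ* = Ωᵢ`, `EᵢEⱼ|Yᵢⱼ| = aᵢⱼ`) and **Thm 2** («Consider the frequency-droop controlled system …
defined on an acyclic network … (i) Synchronization: … a locally exponentially stable and unique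
synchronized solution θ* ∈ Δ_G(γ) … (ii) Flow Feasibility: Γ = ‖diag(a)⁻¹ξ‖_∞ < 1» — the STABLE
one; this file concerns the OTHER synchronized states of the same acyclic network). H.-D. Chiang,
IMA 64 (1995) [Chiang1995] chunk p0048: **Thm 3.1** (global behaviour of gradient / energy-function
systems; tree: `NonuniformKuramotoDichotomy`).

## What is proved (forward solutions `θ` of `θ̇ = field(θ)`: `∀ T, ∀ t ∈ [0,T], HasDerivWithinAt θ (K.field (θ t)) (Icc 0 T) t`)

The ENERGY ROUTE of the twin files for the gradient flow: `U` does not increase along motions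
(`potential_le_of_le`), confined motions have `θ̇ → 0` and converge (Chiang's Thm 3.1 branch,
`tendsto_of_bounded`), cluster points keep the conserved weighted mean phase `Σ Dᵢθᵢ`
(`sum_D_mul_eq`). Hence in the synchronous frame (`Σ ωᵢ = 0`): if `U` is NOT a local minimum at a
synchronized state `θe` that is isolated on its level of `Σ Dᵢθᵢ`, motions started at phases `θ₁` on
the same level, arbitrarily close, with `U(θ₁) < U(θe)`, leave a fixed neighbourhood of `θe` — the
synchronized solution is UNSTABLE.

* §1 `potential_sub_const` (`U(θ − a𝟙) = U(θ) + aΣωᵢ`); **`not_isLocalMin_potential_of_hessForm_neg`**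
  (a synchronized state `field(θ) = 0` with a direction `v`, `½ΣΣ Pᵢⱼcos(θᵢ − θⱼ)(vᵢ − vⱼ)² < 0` ⇒
  `θ` not a local minimum of `U`; transported from the second-order twin).
* §2 **`exists_escape_of_not_isLocalMin_level`** (`Σ ωᵢ = 0`, `Dᵢ > 0`, `P` symmetric, `φ = 0`):
  level isolation + `¬ IsLocalMin U θe` ⇒ ∀ `ε < ρ` ∀ `r > 0` ∃ `θ₁` on the level, `dist(θ₁, θe) < r`,
  `U(θ₁) < U(θe)`, EVERY forward solution from `θ₁` reaches `dist(θ(t), θe) > ε`;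
  **`exists_escape_syncFrame_of_not_isLocalMin`** (frame of the data, `ω_sync = Σωᵢ/ΣDᵢ`: the
  frame orbit `θ(t) − ω_sync t𝟙` leaves the `ε`-ball around `θe`).
* §3 RADIAL NETWORKS: **`unstable_syncState_of_neg_branch_of_tree`** /
  **`unstable_syncSolution_of_neg_branch_of_tree`** (`P` symmetric tree-supported with positive edge
  weights: EVERY synchronized state `ωᵢ − Dᵢω_sync = Σⱼ Pᵢⱼ sin(θeᵢ − θeⱼ)` with a negative-cosine
  edge is an unstable synchronized solution `θe + ω_sync t𝟙`, hypothesis-free);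
  **`unstable_syncSolution_of_ne_cohesive_of_tree`**, **`ncard_unstable_syncStates_of_tree`** (the
  literal count: the pinned synchronized states of the period box other than the phase-cohesive one
  number `2ⁿ⁻¹ − 1` and every one is unstable; the cohesive one is SPDB2013 Thm 2's stable solution,
  whose stability is NOT re-proved here).
* §4 DROOP-CONTROLLED INVERTER NETWORKS (`DroopNetwork.toKuramoto`, SPDB2013 Lemma 1):
  **`DroopNetwork.unstable_syncSolution_of_neg_branch_of_tree`** — in a radial lossless all-inverter
  microgrid (`Dᵢ > 0`, `|Yᵢⱼ|` symmetric and tree-supported, `EᵢEⱼ|Yᵢⱼ| > 0` on the lines) every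
  synchronized solution with a negative-cosine line is unstable.
* §5 (append) «ONE IS STABLE», STATICALLY: **`NonuniformKuramoto.isLocalMin_potential_of_cohesive`**
  (a synchronized state with `Pᵢⱼcos(θᵢ − θⱼ) > 0` on every coupled pair is a local minimum of `U`;
  transported from `ClassicalModel.LosslessSystem.isLocalMin_potential_of_cohesive`) and
  **`isLocalMin_syncPotential_of_cohesive_of_tree`** (radial: the phase-cohesive synchronized state
  is a local minimum of the synchronous-frame potential). Stability of that solution for the
  motions is NOT re-proved here (SPDB2013 Thm 2; `DroopSyncExponentialStability`).

DEVIATIONS FROM THE PRINTED PROOF: as in the twin files (nonlinear Lyapunov instability from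
non-minimum + isolation by the energy argument; no Jacobian spectrum, no nondegeneracy).

THREE COLUMNS (LADDER-GRIDFUSION honest framing). CERTIFIED for MODEL `M` = lossless non-uniform
Kuramoto model `Dᵢθ̇ᵢ = ωᵢ − Σⱼ Pᵢⱼ sin(θᵢ − θⱼ)` (`Dᵢ > 0`, `P` symmetric) ≡ droop-controlled
all-inverter microgrid with inductive lines and constant voltages (MODEL-VALIDITY first-order /
inverter rows); CLASS `C` = initial phase vectors on the level of `θe`, arbitrarily close. «Unstable»
refers to the synchronized solution of MODEL `M`, never to a microgrid. NOT CLAIMED: the stable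
clause for the motions (only its static half, §5); anything for meshed networks without a census;
anything about a physical system.
-/

noncomputable section

open Real Set Filter Topology Metric Finset

namespace Literature.MathematicalPhysics.PowerSystems

namespace NonuniformKuramoto

variable {n : ℕ} (K : NonuniformKuramoto n)

/-! ### §1. Rotations of the potential; the negative-Hessian test -/

/-- A uniform shift of all phases changes the potential by the work of the natural frequencies:
`U(θ − a𝟙) = U(θ) + aΣᵢωᵢ` (rotation-invariant when `Σ ωᵢ = 0`, the synchronous frame).
[cite: ManikTimmeWitthaut2017, §2 («any fixed point θ* is arbitrary up to an additive constant c»); DorflerBullo2012, arXiv:0910.5673 §3.1 (rotational invariance)] -/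
theorem potential_sub_const (θ : Fin n → ℝ) (a : ℝ) :
    -(∑ i, K.ω i * (θ i - a)) - 1 / 2 * ∑ i, ∑ j, K.P i j * Real.cos (θ i - a - (θ j - a))
      = (-(∑ i, K.ω i * θ i) - 1 / 2 * ∑ i, ∑ j, K.P i j * Real.cos (θ i - θ j))
        + a * ∑ i, K.ω i := by
  simp only [sub_sub_sub_cancel_right]
  have h : ∑ i, K.ω i * (θ i - a) = ∑ i, K.ω i * θ i - a * ∑ i, K.ω i := by
    rw [Finset.mul_sum, ← Finset.sum_sub_distrib]
    exact Finset.sum_congr rfl fun i _ => by ring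
  rw [h]
  ring

/-- In the lossless model (`φ = 0`, `Dᵢ ≠ 0`) a synchronized state of the synchronous frame,
`fieldᵢ(θ) = 0`, solves the fixed-point equations `ωᵢ = Σⱼ Pᵢⱼ sin(θᵢ − θⱼ)`.
[cite: ManikTimmeWitthaut2017, §2 («Both the Kuramoto system and the oscillator model of power grids share the same set of fixed points»); DorflerBullo2012, arXiv:0910.5673 §3.1] -/
theorem sum_sin_eq_of_field_eq_zero (hD : ∀ i, K.D i ≠ 0) (hφ : ∀ i j, K.φ i j = 0)
    {θ : Fin n → ℝ} (hθ : ∀ i, K.field θ i = 0) (i : Fin n) :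
    ∑ j, K.P i j * Real.sin (θ i - θ j) = K.ω i := by
  have h := hθ i
  unfold field at h
  rw [div_eq_zero_iff] at h
  rcases h with h | h
  · simp only [hφ, add_zero] at h
    linarith
  · exact absurd h (hD i)

/-- Conversely, a solution of the fixed-point equations is a synchronized state of the synchronous
frame. [cite: ManikTimmeWitthaut2017, §2; DorflerBullo2012, arXiv:0910.5673 §3.1] -/
theorem field_eq_zero_of_sum_sin_eq (hφ : ∀ i j, K.φ i j = 0)
    {θ : Fin n → ℝ} (hθ : ∀ i, ∑ j, K.P i j * Real.sin (θ i - θ j) = K.ω i) (i : Fin n) :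
    K.field θ i = 0 := by
  unfold field
  simp only [hφ, add_zero, hθ i, sub_self, zero_div]

/-- **A negative Hessian direction at a synchronized state ⇒ the potential is NOT a local minimum**
(`φ = 0`, `Dᵢ ≠ 0`, `P` symmetric): `field(θ) = 0` and `½ΣᵢΣⱼ Pᵢⱼ cos(θᵢ − θⱼ)(vᵢ − vⱼ)² < 0` for
some `v` ⇒ `θ` is not a local minimum of `U(θ) = −Σ ωᵢθᵢ − ½ΣΣ Pᵢⱼcos(θᵢ − θⱼ)` (the source's test,
via `ClassicalModel.LosslessSystem.not_isLocalMin_potential_of_hessForm_neg` for the network-reduced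
reading of the same data).
[cite: ManikTimmeWitthaut2017, §3 Lemma 1 and §5.2 proof of Cor. 2] -/
theorem not_isLocalMin_potential_of_hessForm_neg (hD : ∀ i, K.D i ≠ 0)
    (hP : ∀ i j, K.P i j = K.P j i) (hφ : ∀ i j, K.φ i j = 0)
    {θ : Fin n → ℝ} (hθ : ∀ i, K.field θ i = 0) (v : Fin n → ℝ)
    (hv : 1 / 2 * ∑ i, ∑ j, K.P i j * Real.cos (θ i - θ j) * (v i - v j) ^ 2 < 0) :
    ¬ IsLocalMin (fun x : Fin n → ℝ =>
      -(∑ i, K.ω i * x i) - 1 / 2 * ∑ i, ∑ j, K.P i j * Real.cos (x i - x j)) θ := by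
  set L : ClassicalModel.LosslessSystem n 0 :=
    { M := K.D, D := K.D, P := K.ω, C := K.P, K := fun _ b => b.elim0, β := fun b => b.elim0 }
    with hL
  have hLU : L.potential = fun x : Fin n → ℝ =>
      -(∑ i, K.ω i * x i) - 1 / 2 * ∑ i, ∑ j, K.P i j * Real.cos (x i - x j) :=
    funext fun x => by rw [L.potential_eq_of_noBus]
  have hθL : L.IsEquilibrium θ := fun i => by
    show K.ω i = L.flow θ i
    have : L.flow θ i = ∑ j, K.P i j * Real.sin (θ i - θ j) := by
      simp [ClassicalModel.LosslessSystem.flow, hL]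
    rw [this, K.sum_sin_eq_of_field_eq_zero hD hφ hθ i]
  have h := L.not_isLocalMin_potential_of_hessForm_neg hP hθL v (by simpa [hL] using hv)
  rwa [hLU] at h

/-! ### §2. Instability within the level of `Σ Dᵢθᵢ` (synchronous frame) and in the frame of the data -/

/-- From «not a local minimum» to smaller values arbitrarily close (private). [folklore]
[cite: ManikTimmeWitthaut2017, §3 Lemma 1] -/
private theorem exists_lt_of_not_isLocalMin {f : (Fin n → ℝ) → ℝ} {θe : Fin n → ℝ}
    (hmin : ¬ IsLocalMin f θe) {r : ℝ} (hr : 0 < r) :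
    ∃ θ₁ : Fin n → ℝ, dist θ₁ θe < r ∧ f θ₁ < f θe := by
  have h1 : ∃ᶠ θ in 𝓝 θe, ¬ (f θe ≤ f θ) := by
    unfold IsLocalMin IsMinFilter at hmin
    exact Filter.not_eventually.1 hmin
  obtain ⟨θ₁, hθ₁, hlt⟩ := (Metric.nhds_basis_ball.frequently_iff.1 h1) r hr
  exact ⟨θ₁, mem_ball.1 hθ₁, not_le.1 hlt⟩

/-- Along a forward solution with `Σ ωᵢ = 0` every cluster point lies on the level of the initial
phases: `Σ Dᵢxᵢ = Σ Dᵢθᵢ(0)` (private). [folklore] [cite: DorflerBullo2012, arXiv:0910.5673 §5.1 Thm 5.1 statement 2) (conserved quantity)] -/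
private theorem level_eq_of_mapClusterPt (hD : ∀ i, 0 < K.D i) (hP : ∀ i j, K.P i j = K.P j i)
    (hφ : ∀ i j, K.φ i j = 0) (hω : ∑ i, K.ω i = 0) {θ : ℝ → Fin n → ℝ}
    (hθ : ∀ T : ℝ, ∀ t ∈ Icc 0 T, HasDerivWithinAt θ (K.field (θ t)) (Icc 0 T) t)
    {x : Fin n → ℝ} (hx : MapClusterPt x atTop θ) :
    ∑ i, K.D i * x i = ∑ i, K.D i * θ 0 i := by
  set ℓ := ∑ i, K.D i * θ 0 i with hℓ
  set g : (Fin n → ℝ) → ℝ := fun y => ∑ i, K.D i * y i with hg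
  have hlevel : ∀ t, 0 ≤ t → g (θ t) = ℓ := by
    intro t ht
    simp only [hg]
    rw [K.sum_D_mul_eq hD hP hφ hθ ht, hω, zero_mul, add_zero]
  have hgc : Continuous g := by simp only [hg]; fun_prop
  have h1 : MapClusterPt (g x) atTop (g ∘ θ) := hx.continuousAt_comp hgc.continuousAt
  have hconst : Tendsto (g ∘ θ) atTop (𝓝 ℓ) := by
    refine tendsto_const_nhds.congr' ?_
    filter_upwards [eventually_ge_atTop 0] with t ht
    simp only [Function.comp_apply]
    exact (hlevel t ht).symm
  have h2 : ClusterPt (g x) (𝓝 ℓ) := h1.clusterPt.mono hconst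
  exact t2_iff_nhds.1 inferInstance h2

/-- Core of the energy route (private): a forward solution whose initial potential is BELOW
`U(θe)` cannot stay in a closed ball around `θe` in which `θe` is the only possible synchronized
cluster point. [folklore] [cite: Chiang1995, §3 Thm 3.1] -/
private theorem exists_dist_gt_of_potential_lt (hD : ∀ i, 0 < K.D i)
    (hP : ∀ i j, K.P i j = K.P j i) (hφ : ∀ i j, K.φ i j = 0) {θe : Fin n → ℝ} {ε : ℝ}
    {θ : ℝ → Fin n → ℝ} (hθ : ∀ T : ℝ, ∀ t ∈ Icc 0 T, HasDerivWithinAt θ (K.field (θ t)) (Icc 0 T) t)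
    (hE : -(∑ i, K.ω i * θ 0 i) - 1 / 2 * ∑ i, ∑ j, K.P i j * Real.cos (θ 0 i - θ 0 j)
      < -(∑ i, K.ω i * θe i) - 1 / 2 * ∑ i, ∑ j, K.P i j * Real.cos (θe i - θe j))
    (hfix : ∀ x : Fin n → ℝ, dist x θe ≤ ε → MapClusterPt x atTop θ →
      (∀ i, K.field x i = 0) → x = θe) :
    ∃ t, 0 ≤ t ∧ ε < dist (θ t) θe := by
  by_contra hcon
  push Not at hcon
  set U : (Fin n → ℝ) → ℝ := fun x =>
    -(∑ i, K.ω i * x i) - 1 / 2 * ∑ i, ∑ j, K.P i j * Real.cos (x i - x j) with hUdef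
  have hUc : Continuous U := by simp only [hUdef]; fun_prop
  set C : Set (Fin n → ℝ) := closedBall θe ε with hCdef
  have hC : IsCompact C := isCompact_closedBall _ _
  have hθC : ∀ t, 0 ≤ t → θ t ∈ C := fun t ht => mem_closedBall.2 (hcon t ht)
  -- the potential is bounded below on `C`: alternative (b), velocities → 0
  obtain ⟨L, hL⟩ := hC.bddBelow_image hUc.continuousOn
  have hL' : ∀ t, 0 ≤ t →
      L ≤ -(∑ i, K.ω i * θ t i) - 1 / 2 * ∑ i, ∑ j, K.P i j * Real.cos (θ t i - θ t j) :=
    fun t ht => hL ⟨θ t, hθC t ht, rfl⟩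
  obtain ⟨e, he⟩ := K.exists_tendsto_potential_of_bddBelow hD hP hφ hθ hL'
  have hsync := fun i => K.tendsto_field_zero_of_tendsto_potential hD hP hφ hθ he i
  -- every cluster point in `C` is `θe`
  have hev : ∀ᶠ t in atTop, θ t ∈ C := (eventually_ge_atTop 0).mono fun t ht => hθC t ht
  have huniq : ∀ x ∈ C, MapClusterPt x atTop θ → x = θe := by
    intro x hxC hx
    exact hfix x (mem_closedBall.1 hxC) hx fun i => K.field_eq_zero_of_mapClusterPt hsync hx i
  have hlim : Tendsto θ atTop (𝓝 θe) := hC.tendsto_nhds_of_unique_mapClusterPt hev huniq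
  -- so the potential tends to `U(θe)` while staying `≤ U(θ 0) < U(θe)`
  have hElim : Tendsto (fun t => U (θ t)) atTop (𝓝 (U θe)) := (hUc.tendsto _).comp hlim
  have hle : U θe ≤ U (θ 0) :=
    le_of_tendsto hElim ((eventually_ge_atTop 0).mono fun t ht =>
      K.potential_le_of_le hD hP hφ hθ le_rfl ht)
  have hE' : U (θ 0) < U θe := hE
  linarith

/-- **INSTABILITY WITHIN THE LEVEL (lossless first-order model in its synchronous frame:
`Σ ωᵢ = 0`; `Dᵢ > 0`, `P` symmetric, `φ = 0`).** Let `θe` be a phase vector near which the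
synchronized states (`field = 0`) ON THE LEVEL `Σ Dᵢθᵢ = Σ Dᵢθeᵢ` are isolated (radius `ρ`), and at
which `U(θ) = −Σ ωᵢθᵢ − ½ΣΣ Pᵢⱼcos(θᵢ − θⱼ)` is NOT a local minimum. Then for every `ε < ρ` and
`r > 0` there is `θ₁` on the same level, `dist(θ₁, θe) < r`, `U(θ₁) < U(θe)`, such that EVERY
forward solution from `θ₁` (it exists and is unique, `exists_globalSolution` /
`globalSolution_unique`) reaches `dist(θ(t), θe) > ε` at some `t ≥ 0`: the gradient flow lowers
`U`, so a motion starting below `U(θe)` can return near `θe` for good only by converging to a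
synchronized state there, i.e. to `θe` — which would raise `U` back to `U(θe)`. THREE COLUMNS:
CERTIFIED for MODEL `M` = lossless non-uniform Kuramoto / droop network in the synchronous frame,
CLASS `C` = initial phases on the leaf of `θe` arbitrarily close; NOT CLAIMED: anything off the
leaf, anything about a microgrid.
[cite: ManikTimmeWitthaut2017, §3 Lemma 1 («for both Kuramoto system and the power grid model system») and §5.2 Cor. 2; Chiang1995, §3 Thm 3.1; DorflerBullo2012, arXiv:0910.5673 §4.1 proof of Lemma 4.1] -/
theorem exists_escape_of_not_isLocalMin_level (hD : ∀ i, 0 < K.D i)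
    (hP : ∀ i j, K.P i j = K.P j i) (hφ : ∀ i j, K.φ i j = 0) (hω : ∑ i, K.ω i = 0)
    {θe : Fin n → ℝ} {ρ : ℝ}
    (hiso : ∀ θ : Fin n → ℝ, (∀ i, K.field θ i = 0) → ∑ i, K.D i * θ i = ∑ i, K.D i * θe i →
      dist θ θe < ρ → θ = θe)
    (hmin : ¬ IsLocalMin (fun x : Fin n → ℝ =>
      -(∑ i, K.ω i * x i) - 1 / 2 * ∑ i, ∑ j, K.P i j * Real.cos (x i - x j)) θe)
    {ε : ℝ} (hερ : ε < ρ) {r : ℝ} (hr : 0 < r) :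
    ∃ θ₁ : Fin n → ℝ, dist θ₁ θe < r ∧ ∑ i, K.D i * θ₁ i = ∑ i, K.D i * θe i ∧
      (-(∑ i, K.ω i * θ₁ i) - 1 / 2 * ∑ i, ∑ j, K.P i j * Real.cos (θ₁ i - θ₁ j)
        < -(∑ i, K.ω i * θe i) - 1 / 2 * ∑ i, ∑ j, K.P i j * Real.cos (θe i - θe j)) ∧
      ∀ θ : ℝ → Fin n → ℝ, θ 0 = θ₁ →
        (∀ T : ℝ, ∀ t ∈ Icc 0 T, HasDerivWithinAt θ (K.field (θ t)) (Icc 0 T) t) →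
        ∃ t, 0 ≤ t ∧ ε < dist (θ t) θe := by
  rcases Nat.eq_zero_or_pos n with hn | hn
  · subst hn
    obtain ⟨θ₀, -, hlt⟩ := exists_lt_of_not_isLocalMin hmin one_pos
    rw [Subsingleton.elim θ₀ θe] at hlt
    exact absurd hlt (lt_irrefl _)
  haveI : Nonempty (Fin n) := ⟨⟨0, hn⟩⟩
  have hDs : 0 < ∑ i, K.D i := Finset.sum_pos (fun i _ => hD i) Finset.univ_nonempty
  obtain ⟨θ'', hθ''d, hθ''U⟩ := exists_lt_of_not_isLocalMin hmin (half_pos hr)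
  set a : ℝ := (∑ i, K.D i * (θ'' i - θe i)) / ∑ i, K.D i with ha
  set θ₁ : Fin n → ℝ := fun j => θ'' j - a with hθ₁
  have hlev : ∑ i, K.D i * θ₁ i = ∑ i, K.D i * θe i := by
    have h1 : ∑ i, K.D i * θ₁ i = ∑ i, K.D i * θ'' i - a * ∑ i, K.D i := by
      simp only [hθ₁]
      rw [Finset.mul_sum, ← Finset.sum_sub_distrib]
      exact Finset.sum_congr rfl fun i _ => by ring
    have h2 : a * ∑ i, K.D i = ∑ i, K.D i * (θ'' i - θe i) := by
      rw [ha, div_mul_cancel₀ _ hDs.ne']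
    have h3 : ∑ i, K.D i * (θ'' i - θe i) = ∑ i, K.D i * θ'' i - ∑ i, K.D i * θe i := by
      rw [← Finset.sum_sub_distrib]
      exact Finset.sum_congr rfl fun i _ => by ring
    rw [h1, h2, h3]
    ring
  have hU₁ : -(∑ i, K.ω i * θ₁ i) - 1 / 2 * ∑ i, ∑ j, K.P i j * Real.cos (θ₁ i - θ₁ j)
      = -(∑ i, K.ω i * θ'' i) - 1 / 2 * ∑ i, ∑ j, K.P i j * Real.cos (θ'' i - θ'' j) := by
    simp only [hθ₁]
    rw [K.potential_sub_const, hω, mul_zero, add_zero]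
  have habs : |a| ≤ dist θ'' θe := by
    rw [ha, abs_div, abs_of_pos hDs, div_le_iff₀ hDs]
    calc |∑ i, K.D i * (θ'' i - θe i)| ≤ ∑ i, |K.D i * (θ'' i - θe i)| :=
          Finset.abs_sum_le_sum_abs _ _
      _ = ∑ i, K.D i * |θ'' i - θe i| :=
          Finset.sum_congr rfl fun i _ => by rw [abs_mul, abs_of_pos (hD i)]
      _ ≤ ∑ i, K.D i * dist θ'' θe :=
          Finset.sum_le_sum fun i _ => mul_le_mul_of_nonneg_left
            (by rw [← Real.dist_eq]; exact dist_le_pi_dist θ'' θe i) (hD i).le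
      _ = dist θ'' θe * ∑ i, K.D i := by rw [mul_comm, Finset.sum_mul]
  have hdist : dist θ₁ θe < r := by
    have h1 : dist θ₁ θe ≤ dist θ'' θe + |a| := by
      refine (dist_pi_le_iff (by positivity)).2 fun j => ?_
      rw [Real.dist_eq]
      calc |θ₁ j - θe j| = |(θ'' j - θe j) - a| := by simp only [hθ₁]; ring_nf
        _ ≤ |θ'' j - θe j| + |a| := abs_sub _ _
        _ ≤ dist θ'' θe + |a| := by
            rw [← Real.dist_eq]; linarith [dist_le_pi_dist θ'' θe j]
    linarith
  refine ⟨θ₁, hdist, hlev, by rw [hU₁]; exact hθ''U, fun θ hθ0 hθ => ?_⟩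
  refine K.exists_dist_gt_of_potential_lt hD hP hφ hθ ?_ fun x hxε hx hx0 => ?_
  · rw [hθ0, hU₁]; exact hθ''U
  · have hlx : ∑ i, K.D i * x i = ∑ i, K.D i * θe i := by
      rw [K.level_eq_of_mapClusterPt hD hP hφ hω hθ hx, hθ0, hlev]
    exact hiso x hx0 hlx (lt_of_le_of_lt hxε hερ)

/-- **The same in the frame of the data** (`ω_sync = Σωᵢ/ΣDᵢ`; `Dᵢ > 0`, `P` symmetric, `φ = 0`).
Let `θe` be a SYNCHRONIZED STATE (`fieldᵢ(θe) = ω_sync` for all `i`: all phases rotate rigidly),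
isolated near itself among synchronized states on its level of `Σ Dᵢθᵢ` (radius `ρ`), at which the
synchronous-frame potential `Ũ(θ) = −Σ(ωᵢ − Dᵢω_sync)θᵢ − ½ΣΣ Pᵢⱼcos(θᵢ − θⱼ)` is NOT a local
minimum. Then ∀ `ε < ρ` ∀ `r > 0` ∃ `θ₁` on the same level, `dist(θ₁, θe) < r`, such that EVERY
forward solution from `θ₁` has its frame orbit `θ(t) − ω_sync t𝟙` leave the `ε`-ball around `θe` —
its distance to the synchronized solution `θe + ω_sync t𝟙` exceeds `ε` at some `t ≥ 0`.
[cite: ManikTimmeWitthaut2017, §3 Lemma 1 and §5.2 Cor. 2; SimpsonporcoDorflerBullo2013, §3 (rotating frame, `ω_sync = ω_avg`); Chiang1995, §3 Thm 3.1] -/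
theorem exists_escape_syncFrame_of_not_isLocalMin (hD : ∀ i, 0 < K.D i)
    (hP : ∀ i j, K.P i j = K.P j i) (hφ : ∀ i j, K.φ i j = 0) {θe : Fin n → ℝ} {ρ : ℝ}
    (hiso : ∀ θ : Fin n → ℝ, (∀ i, K.field θ i = (∑ j, K.ω j) / ∑ j, K.D j) →
      ∑ i, K.D i * θ i = ∑ i, K.D i * θe i → dist θ θe < ρ → θ = θe)
    (hmin : ¬ IsLocalMin (fun x : Fin n → ℝ =>
      -(∑ i, (K.ω i - K.D i * ((∑ j, K.ω j) / ∑ j, K.D j)) * x i)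
        - 1 / 2 * ∑ i, ∑ j, K.P i j * Real.cos (x i - x j)) θe)
    {ε : ℝ} (hερ : ε < ρ) {r : ℝ} (hr : 0 < r) :
    ∃ θ₁ : Fin n → ℝ, dist θ₁ θe < r ∧ ∑ i, K.D i * θ₁ i = ∑ i, K.D i * θe i ∧
      ∀ θ : ℝ → Fin n → ℝ, θ 0 = θ₁ →
        (∀ T : ℝ, ∀ t ∈ Icc 0 T, HasDerivWithinAt θ (K.field (θ t)) (Icc 0 T) t) →
        ∃ t, 0 ≤ t ∧ ε < dist (fun j => θ t j - (∑ j, K.ω j) / (∑ j, K.D j) * t) θe := by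
  set c := (∑ j, K.ω j) / ∑ j, K.D j with hc
  set Kc : NonuniformKuramoto n := { K with ω := fun j => K.ω j - K.D j * c } with hKc
  have hD0 : ∀ i, K.D i ≠ 0 := fun i => (hD i).ne'
  have hDc : ∀ i, 0 < Kc.D i := hD
  have hPc : ∀ i j, Kc.P i j = Kc.P j i := hP
  have hφc : ∀ i j, Kc.φ i j = 0 := hφ
  have hωc : ∑ i, Kc.ω i = 0 := by
    rcases Nat.eq_zero_or_pos n with hn | hn
    · subst hn; simp
    · haveI : Nonempty (Fin n) := ⟨⟨0, hn⟩⟩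
      exact K.sum_omega_syncFrame (Finset.sum_pos (fun i _ => hD i) Finset.univ_nonempty).ne'
  have hisoc : ∀ θ : Fin n → ℝ, (∀ i, Kc.field θ i = 0) → ∑ i, Kc.D i * θ i = ∑ i, Kc.D i * θe i →
      dist θ θe < ρ → θ = θe := by
    intro θ hθ hl hd
    refine hiso θ (fun i => ?_) hl hd
    have h := hθ i
    rw [K.field_rotatingFrame c hD0] at h
    linarith
  obtain ⟨θ₁, hd, hlev, -, hesc⟩ :=
    Kc.exists_escape_of_not_isLocalMin_level hDc hPc hφc hωc hisoc hmin hερ hr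
  refine ⟨θ₁, hd, hlev, fun θ hθ0 hθ => ?_⟩
  have hθc := K.globalSolution_rotatingFrame c hD0 hθ
  have h0 : (fun s => fun j => θ s j - c * s) 0 = θ₁ := by
    funext j; simp [hθ0]
  exact hesc (fun s => fun j => θ s j - c * s) h0 hθc

/-! ### §3. RADIAL NETWORKS (Cor. 2, «unstable» clause, first-order motions) -/

/-- **On a radial network every synchronized state of the lossless first-order model with a
negative-cosine edge is an UNSTABLE synchronized solution** (`Dᵢ > 0`, `φ = 0`, `P` symmetric
supported on the edges of a rooted tree with positive edge weights `P_{i, parent i} > 0`). Let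
`θe` satisfy `fieldᵢ(θe) = ω_sync` for all `i` with `cos(θeᵢ − θe_{parent i}) < 0` on some edge.
Then `∃ ε > 0 ∀ r > 0 ∃ θ₁` on the level `Σ Dₖθ₁ₖ = Σ Dₖθeₖ` with `dist(θ₁, θe) < r` such that EVERY
forward solution from `θ₁` has its frame orbit `θ(t) − ω_sync t𝟙` leave the `ε`-ball around `θe`.
Ingredients: not a minimum by the subtree shift (`RadialNetwork.exists_potential_lt_of_neg_branch`);
finitely many synchronized states per period (`RadialNetwork.finite_pinned_equilibria`) ⇒ level
isolation (`exists_levelIsolation_of_finite_syncStates`); §2. THREE COLUMNS: CERTIFIED for MODEL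
`M` = lossless non-uniform Kuramoto / droop network on a RADIAL graph, CLASS `C` = initial phases on
the leaf arbitrarily close; NOT CLAIMED: the stable clause (SPDB2013 Thm 2's solution), anything
about a microgrid.
[cite: ManikTimmeWitthaut2017, §5.2 Cor. 2 and its proof, §3 Lemma 1; SimpsonporcoDorflerBullo2013, §3 Thm 2 (acyclic networks; the stable synchronized solution); Chiang1995, §3 Thm 3.1] -/
theorem unstable_syncState_of_neg_branch_of_tree (hD : ∀ i, 0 < K.D i)
    (hP : ∀ i j, K.P i j = K.P j i) (hφ : ∀ i j, K.φ i j = 0)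
    {root : Fin n} {parent : Fin n → Fin n} {depth : Fin n → ℕ} (hpr : parent root = root)
    (hdepth : ∀ i, i ≠ root → depth i = depth (parent i) + 1)
    (htree : ∀ i j, i ≠ j → K.P i j ≠ 0 → (i ≠ root ∧ j = parent i) ∨ (j ≠ root ∧ i = parent j))
    (ha : ∀ i, i ≠ root → 0 < K.P i (parent i))
    {θe : Fin n → ℝ} (he : ∀ k, K.field θe k = (∑ j, K.ω j) / ∑ j, K.D j)
    {i : Fin n} (hi : i ≠ root) (hneg : Real.cos (θe i - θe (parent i)) < 0) :
    ∃ ε > 0, ∀ r > 0, ∃ θ₁ : Fin n → ℝ, dist θ₁ θe < r ∧ ∑ k, K.D k * θ₁ k = ∑ k, K.D k * θe k ∧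
      ∀ θ : ℝ → Fin n → ℝ, θ 0 = θ₁ →
        (∀ T : ℝ, ∀ t ∈ Icc 0 T, HasDerivWithinAt θ (K.field (θ t)) (Icc 0 T) t) →
        ∃ t, 0 ≤ t ∧ ε < dist (fun j => θ t j - (∑ j, K.ω j) / (∑ j, K.D j) * t) θe := by
  set c := (∑ j, K.ω j) / ∑ j, K.D j with hc
  set Kc : NonuniformKuramoto n := { K with ω := fun j => K.ω j - K.D j * c } with hKc
  have hD0 : ∀ i, K.D i ≠ 0 := fun i => (hD i).ne'
  -- synchronized states at frequency `c` = solutions of the fixed-point equations with `ω − Dc`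
  have hfix : ∀ θ : Fin n → ℝ, (∀ k, K.field θ k = c) ↔
      ∀ k, ∑ j, K.P k j * Real.sin (θ k - θ j) = Kc.ω k := by
    intro θ
    constructor
    · intro h k
      have h1 : ∀ k, Kc.field θ k = 0 := fun k => by
        rw [K.field_rotatingFrame c hD0, h k, sub_self]
      exact Kc.sum_sin_eq_of_field_eq_zero hD0 hφ h1 k
    · intro h k
      have h1 : Kc.field θ k = 0 := Kc.field_eq_zero_of_sum_sin_eq hφ h k
      rw [K.field_rotatingFrame c hD0] at h1
      linarith
  -- the finite pinned census of the tree, hence level isolation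
  have hfinIco := ClassicalModel.RadialNetwork.finite_pinned_equilibria hdepth K.P hP htree
    (fun k hk => (ha k hk).ne') Kc.ω
  have hfinIcc := ClassicalModel.UnicyclicNetwork.finite_pinned_Icc_of_finite_pinned_Ico K.P Kc.ω
    root hfinIco
  obtain ⟨ρ, hρ, hisoG⟩ := K.exists_levelIsolation_of_finite_syncStates hD root c
    (hfinIcc.subset fun θ ⟨h1, h2, h3⟩ => ⟨h1, h2, (hfix θ).1 h3⟩)
  have hiso : ∀ θ : Fin n → ℝ, (∀ k, K.field θ k = c) →
      ∑ k, K.D k * θ k = ∑ k, K.D k * θe k → dist θ θe < ρ → θ = θe :=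
    fun θ hθ hl hd => hisoG θ θe hθ he hl hd
  -- not a local minimum of the frame potential (subtree shift)
  have heq : ∀ k, ∑ j, K.P k j * Real.sin (θe k - θe j) = Kc.ω k := (hfix θe).1 he
  have hmin : ¬ IsLocalMin (fun x : Fin n → ℝ =>
      -(∑ k, (K.ω k - K.D k * c) * x k) - 1 / 2 * ∑ k, ∑ l, K.P k l * Real.cos (x k - x l)) θe := by
    intro hloc
    have hev : ∀ᶠ θ in 𝓝 θe,
        (-(∑ k, (K.ω k - K.D k * c) * θe k) - 1 / 2 * ∑ k, ∑ l, K.P k l * Real.cos (θe k - θe l))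
          ≤ -(∑ k, (K.ω k - K.D k * c) * θ k) - 1 / 2 * ∑ k, ∑ l, K.P k l * Real.cos (θ k - θ l) :=
      hloc
    rw [Metric.eventually_nhds_iff] at hev
    obtain ⟨ε₀, hε₀, hle⟩ := hev
    obtain ⟨θ', hθ'd, hθ'U⟩ := ClassicalModel.RadialNetwork.exists_potential_lt_of_neg_branch hpr
      hdepth K.P hP htree Kc.ω heq hi (ha i hi) hneg hε₀
    have h1 := hle hθ'd
    have h2 : ∀ x : Fin n → ℝ, -(∑ k, (K.ω k - K.D k * c) * x k) = -∑ k, Kc.ω k * x k :=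
      fun x => rfl
    rw [h2, h2] at h1
    exact absurd h1 (not_le.2 hθ'U)
  refine ⟨ρ / 2, by positivity, fun r hr => ?_⟩
  exact K.exists_escape_syncFrame_of_not_isLocalMin hD hP hφ hiso hmin (ε := ρ / 2)
    (by linarith) hr

/-- The frame distance to `θe` is the distance to the synchronized solution `θe + ct𝟙`.
[cite: SimpsonporcoDorflerBullo2013, §3 (rotating frame)] -/
theorem dist_frame_eq (x θe : Fin n → ℝ) (c t : ℝ) :
    dist (fun j => x j - c * t) θe = dist x (fun j => θe j + c * t) := by
  rw [dist_eq_norm, dist_eq_norm]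
  congr 1
  funext j
  simp only [Pi.sub_apply]
  ring

/-- **Cor. 2, «unstable» clause, against the synchronized solution itself** (radial network,
lossless first-order model): a synchronized state `θe` with a negative-cosine edge gives an UNSTABLE
synchronized solution `t ↦ θe + ω_sync t𝟙` — `∃ ε > 0 ∀ r > 0 ∃ θ₁` on the leaf with
`dist(θ₁, θe) < r` such that every forward solution from `θ₁` satisfies
`dist(θ(t), θe + ω_sync t𝟙) > ε` at some `t ≥ 0`.
[cite: ManikTimmeWitthaut2017, §5.2 Cor. 2 («one is stable and 2^{N−1} − 1 are unstable») and §3 Lemma 1; SimpsonporcoDorflerBullo2013, §3 Thm 2; Chiang1995, §3 Thm 3.1] -/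
theorem unstable_syncSolution_of_neg_branch_of_tree (hD : ∀ i, 0 < K.D i)
    (hP : ∀ i j, K.P i j = K.P j i) (hφ : ∀ i j, K.φ i j = 0)
    {root : Fin n} {parent : Fin n → Fin n} {depth : Fin n → ℕ} (hpr : parent root = root)
    (hdepth : ∀ i, i ≠ root → depth i = depth (parent i) + 1)
    (htree : ∀ i j, i ≠ j → K.P i j ≠ 0 → (i ≠ root ∧ j = parent i) ∨ (j ≠ root ∧ i = parent j))
    (ha : ∀ i, i ≠ root → 0 < K.P i (parent i))
    {θe : Fin n → ℝ} (he : ∀ k, K.field θe k = (∑ j, K.ω j) / ∑ j, K.D j)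
    {i : Fin n} (hi : i ≠ root) (hneg : Real.cos (θe i - θe (parent i)) < 0) :
    ∃ ε > 0, ∀ r > 0, ∃ θ₁ : Fin n → ℝ, dist θ₁ θe < r ∧ ∑ k, K.D k * θ₁ k = ∑ k, K.D k * θe k ∧
      ∀ θ : ℝ → Fin n → ℝ, θ 0 = θ₁ →
        (∀ T : ℝ, ∀ t ∈ Icc 0 T, HasDerivWithinAt θ (K.field (θ t)) (Icc 0 T) t) →
        ∃ t, 0 ≤ t ∧ ε < dist (θ t) (fun j => θe j + (∑ j, K.ω j) / (∑ j, K.D j) * t) := by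
  obtain ⟨ε, hε, h⟩ :=
    K.unstable_syncState_of_neg_branch_of_tree hD hP hφ hpr hdepth htree ha he hi hneg
  refine ⟨ε, hε, fun r hr => ?_⟩
  obtain ⟨θ₁, hd, hl, hesc⟩ := h r hr
  refine ⟨θ₁, hd, hl, fun θ hθ0 hθ => ?_⟩
  obtain ⟨t, ht, hdist⟩ := hesc θ hθ0 hθ
  exact ⟨t, ht, by rwa [dist_frame_eq] at hdist⟩

/-- **Every pinned synchronized state other than the phase-cohesive one is an unstable synchronized
solution** (radial network, lossless first-order model): if `θc` is a synchronized state of the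
period box `[−π, π)ⁿ` pinned at the root with all edge cosines `≥ 0` (SPDB2013 Thm 2's solution in
`Δ_G(γ)`), every OTHER pinned synchronized state `θe` of the box is unstable.
[cite: ManikTimmeWitthaut2017, §5.2 Cor. 2 and its proof; SimpsonporcoDorflerBullo2013, §3 Thm 2; Chiang1995, §3 Thm 3.1] -/
theorem unstable_syncSolution_of_ne_cohesive_of_tree (hD : ∀ i, 0 < K.D i)
    (hP : ∀ i j, K.P i j = K.P j i) (hφ : ∀ i j, K.φ i j = 0)
    {root : Fin n} {parent : Fin n → Fin n} {depth : Fin n → ℕ} (hpr : parent root = root)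
    (hdepth : ∀ i, i ≠ root → depth i = depth (parent i) + 1)
    (htree : ∀ i j, i ≠ j → K.P i j ≠ 0 → (i ≠ root ∧ j = parent i) ∨ (j ≠ root ∧ i = parent j))
    (ha : ∀ i, i ≠ root → 0 < K.P i (parent i))
    {θc : Fin n → ℝ} (hrc : θc root = 0) (hboxc : ∀ i, θc i ∈ Set.Ico (-π) π)
    (hec : ∀ k, K.field θc k = (∑ j, K.ω j) / ∑ j, K.D j)
    (hcoh : ∀ i, i ≠ root → 0 ≤ Real.cos (θc i - θc (parent i)))
    {θe : Fin n → ℝ} (hr : θe root = 0) (hbox : ∀ i, θe i ∈ Set.Ico (-π) π)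
    (he : ∀ k, K.field θe k = (∑ j, K.ω j) / ∑ j, K.D j) (hne : θe ≠ θc) :
    ∃ ε > 0, ∀ r > 0, ∃ θ₁ : Fin n → ℝ, dist θ₁ θe < r ∧ ∑ k, K.D k * θ₁ k = ∑ k, K.D k * θe k ∧
      ∀ θ : ℝ → Fin n → ℝ, θ 0 = θ₁ →
        (∀ T : ℝ, ∀ t ∈ Icc 0 T, HasDerivWithinAt θ (K.field (θ t)) (Icc 0 T) t) →
        ∃ t, 0 ≤ t ∧ ε < dist (θ t) (fun j => θe j + (∑ j, K.ω j) / (∑ j, K.D j) * t) := by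
  set c := (∑ j, K.ω j) / ∑ j, K.D j with hc
  set Kc : NonuniformKuramoto n := { K with ω := fun j => K.ω j - K.D j * c } with hKc
  have hD0 : ∀ i, K.D i ≠ 0 := fun i => (hD i).ne'
  have hsum : ∀ θ : Fin n → ℝ, (∀ k, K.field θ k = c) →
      ∀ k, ∑ j, K.P k j * Real.sin (θ k - θ j) = Kc.ω k := by
    intro θ h k
    have h1 : ∀ k, Kc.field θ k = 0 := fun k => by
      rw [K.field_rotatingFrame c hD0, h k, sub_self]
    exact Kc.sum_sin_eq_of_field_eq_zero hD0 hφ h1 k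
  obtain ⟨i, hi, hneg⟩ := ClassicalModel.RadialNetwork.exists_neg_branch_of_ne_cohesive hdepth K.P
    hP htree (fun k hk => (ha k hk).ne') Kc.ω hr hbox (hsum θe he) hrc hboxc (hsum θc hec) hcoh hne
  exact K.unstable_syncSolution_of_neg_branch_of_tree hD hP hφ hpr hdepth htree ha he hi hneg

/-- **«Of the `2ᴺ⁻¹` fixed points … `2ᴺ⁻¹ − 1` are unstable», for the first-order motions on a
radial network with strictly feasible tree flows** (SPDB2013's «Flow Feasibility» `Γ < 1`): with the
tree flows `u` of the frame frequencies `ωᵢ − Dᵢω_sync` (`|uᵢ| < P_{i,parent i}`), the pinned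
synchronized states of the period box number exactly `2ⁿ⁻¹` (`RadialNetwork.ncard_pinned_equilibria_eq`);
if `θc` is the phase-cohesive one (the locally exponentially stable solution of SPDB2013 Thm 2 —
stability NOT re-proved here), the OTHER `2ⁿ⁻¹ − 1` are, every one, unstable synchronized solutions.
[cite: ManikTimmeWitthaut2017, §5.2 Cor. 2; SimpsonporcoDorflerBullo2013, §3 Thm 2 ((i) ⇔ (ii), acyclic network); DorflerChertkovBullo2013, SI §3.2 Thm 2 (G1); Chiang1995, §3 Thm 3.1] -/
theorem ncard_unstable_syncStates_of_tree (hD : ∀ i, 0 < K.D i)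
    (hP : ∀ i j, K.P i j = K.P j i) (hφ : ∀ i j, K.φ i j = 0)
    {root : Fin n} {parent : Fin n → Fin n} {depth : Fin n → ℕ} (hpr : parent root = root)
    (hroot : depth root = 0) (hdepth : ∀ i, i ≠ root → depth i = depth (parent i) + 1)
    (htree : ∀ i j, i ≠ j → K.P i j ≠ 0 → (i ≠ root ∧ j = parent i) ∨ (j ≠ root ∧ i = parent j))
    (ha : ∀ i, i ≠ root → 0 < K.P i (parent i)) (u : Fin n → ℝ)
    (hcons : ∀ i, K.ω i - K.D i * ((∑ j, K.ω j) / ∑ j, K.D j) = (if i ≠ root then u i else 0)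
      - ∑ j ∈ Finset.univ.filter (fun j => j ≠ root ∧ parent j = i), u j)
    (hu : ∀ i, i ≠ root → |u i| < K.P i (parent i))
    {θc : Fin n → ℝ} (hrc : θc root = 0) (hboxc : ∀ i, θc i ∈ Set.Ico (-π) π)
    (hec : ∀ k, K.field θc k = (∑ j, K.ω j) / ∑ j, K.D j)
    (hcoh : ∀ i, i ≠ root → 0 ≤ Real.cos (θc i - θc (parent i))) :
    ({θ : Fin n → ℝ | θ root = 0 ∧ (∀ i, θ i ∈ Set.Ico (-π) π) ∧
        ∀ k, K.field θ k = (∑ j, K.ω j) / ∑ j, K.D j} \ {θc}).ncard = 2 ^ (n - 1) - 1 ∧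
      ∀ θe ∈ {θ : Fin n → ℝ | θ root = 0 ∧ (∀ i, θ i ∈ Set.Ico (-π) π) ∧
          ∀ k, K.field θ k = (∑ j, K.ω j) / ∑ j, K.D j} \ {θc},
        ∃ ε > 0, ∀ r > 0, ∃ θ₁ : Fin n → ℝ, dist θ₁ θe < r ∧
          ∑ k, K.D k * θ₁ k = ∑ k, K.D k * θe k ∧
          ∀ θ : ℝ → Fin n → ℝ, θ 0 = θ₁ →
            (∀ T : ℝ, ∀ t ∈ Icc 0 T, HasDerivWithinAt θ (K.field (θ t)) (Icc 0 T) t) →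
            ∃ t, 0 ≤ t ∧ ε < dist (θ t) (fun j => θe j + (∑ j, K.ω j) / (∑ j, K.D j) * t) := by
  set c := (∑ j, K.ω j) / ∑ j, K.D j with hc
  set Kc : NonuniformKuramoto n := { K with ω := fun j => K.ω j - K.D j * c } with hKc
  have hD0 : ∀ i, K.D i ≠ 0 := fun i => (hD i).ne'
  have hfix : ∀ θ : Fin n → ℝ, (∀ k, K.field θ k = c) ↔
      ∀ k, ∑ j, K.P k j * Real.sin (θ k - θ j) = Kc.ω k := by
    intro θ
    constructor
    · intro h k
      have h1 : ∀ k, Kc.field θ k = 0 := fun k => by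
        rw [K.field_rotatingFrame c hD0, h k, sub_self]
      exact Kc.sum_sin_eq_of_field_eq_zero hD0 hφ h1 k
    · intro h k
      have h1 : Kc.field θ k = 0 := Kc.field_eq_zero_of_sum_sin_eq hφ h k
      rw [K.field_rotatingFrame c hD0] at h1
      linarith
  set E : Set (Fin n → ℝ) := {θ : Fin n → ℝ | θ root = 0 ∧ (∀ i, θ i ∈ Set.Ico (-π) π) ∧
    ∀ k, K.field θ k = c} with hE
  have hEeq : E = {θ : Fin n → ℝ | θ root = 0 ∧ (∀ i, θ i ∈ Set.Ico (-π) π) ∧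
      ∀ k, ∑ j, K.P k j * Real.sin (θ k - θ j) = Kc.ω k} := by
    ext θ
    simp only [hE, Set.mem_setOf_eq]
    exact ⟨fun ⟨h1, h2, h3⟩ => ⟨h1, h2, (hfix θ).1 h3⟩, fun ⟨h1, h2, h3⟩ => ⟨h1, h2, (hfix θ).2 h3⟩⟩
  have hfin : E.Finite := by
    rw [hEeq]
    exact ClassicalModel.RadialNetwork.finite_pinned_equilibria hdepth K.P hP htree
      (fun k hk => (ha k hk).ne') _
  have hcard : E.ncard = 2 ^ (n - 1) := by
    rw [hEeq]
    exact ClassicalModel.RadialNetwork.ncard_pinned_equilibria_eq hroot hdepth K.P hP htree ha _ u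
      hcons hu
  have hmem : θc ∈ E := ⟨hrc, hboxc, hec⟩
  refine ⟨by rw [Set.ncard_sdiff_singleton_of_mem hmem, hcard], ?_⟩
  rintro θe ⟨⟨hr, hbox, he⟩, hne⟩
  exact K.unstable_syncSolution_of_ne_cohesive_of_tree hD hP hφ hpr hdepth htree ha hrc hboxc hec
    hcoh hr hbox he hne

end NonuniformKuramoto

/-! ### §4. Droop-controlled inverter networks (SPDB2013 Lemma 1: `DroopNetwork.toKuramoto`) -/

namespace DroopNetwork

variable {n : ℕ} (N : DroopNetwork n)

/-- **In a radial lossless droop-controlled all-inverter microgrid every synchronized solution with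
a negative-cosine line is UNSTABLE** (`Dᵢ > 0` at every node, symmetric susceptance magnitudes
`|Yᵢⱼ|`, Kuramoto weights `aᵢⱼ = EᵢEⱼ|Yᵢⱼ|` supported on the lines of a rooted tree and positive on
them): if `θe` rotates rigidly at `ω_sync = ΣPᵢ*/ΣDᵢ` (`(Pᵢ* − P_e,i(θe))/Dᵢ = ω_sync` at every node)
and `cos(θeᵢ − θe_{parent i}) < 0` on some line, then `∃ ε > 0 ∀ r > 0 ∃ θ₁` on the leaf of `θe`
with `dist(θ₁, θe) < r` such that every forward solution of `Dᵢθ̇ᵢ = Pᵢ* − P_e,i(θ)` from `θ₁`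
satisfies `dist(θ(t), θe + ω_sync t𝟙) > ε` at some `t ≥ 0`. (SPDB2013 Thm 2 gives the ONE locally
exponentially stable synchronized solution of the acyclic network; this is the fate of the others.)
[cite: SimpsonporcoDorflerBullo2013, §3 Lemma 1 and Thm 2 (acyclic network); ManikTimmeWitthaut2017, §5.2 Cor. 2 and §3 Lemma 1; Chiang1995, §3 Thm 3.1] -/
theorem unstable_syncSolution_of_neg_branch_of_tree (hD : ∀ i, 0 < N.Dc i)
    (hY : ∀ i j, N.Yabs i j = N.Yabs j i)
    {root : Fin n} {parent : Fin n → Fin n} {depth : Fin n → ℕ} (hpr : parent root = root)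
    (hdepth : ∀ i, i ≠ root → depth i = depth (parent i) + 1)
    (htree : ∀ i j, i ≠ j → N.toKuramoto.P i j ≠ 0 →
      (i ≠ root ∧ j = parent i) ∨ (j ≠ root ∧ i = parent j))
    (ha : ∀ i, i ≠ root → 0 < N.toKuramoto.P i (parent i))
    {θe : Fin n → ℝ} (he : ∀ k, N.toKuramoto.field θe k = (∑ j, N.Pstar j) / ∑ j, N.Dc j)
    {i : Fin n} (hi : i ≠ root) (hneg : Real.cos (θe i - θe (parent i)) < 0) :
    ∃ ε > 0, ∀ r > 0, ∃ θ₁ : Fin n → ℝ, dist θ₁ θe < r ∧ ∑ k, N.Dc k * θ₁ k = ∑ k, N.Dc k * θe k ∧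
      ∀ θ : ℝ → Fin n → ℝ, θ 0 = θ₁ →
        (∀ T : ℝ, ∀ t ∈ Icc 0 T, HasDerivWithinAt θ (N.toKuramoto.field (θ t)) (Icc 0 T) t) →
        ∃ t, 0 ≤ t ∧ ε < dist (θ t) (fun j => θe j + (∑ j, N.Pstar j) / (∑ j, N.Dc j) * t) :=
  N.toKuramoto.unstable_syncSolution_of_neg_branch_of_tree hD (N.toKuramoto_P_symm hY)
    (fun _ _ => rfl) hpr hdepth htree ha he hi hneg

end DroopNetwork

/-! ### §5. (Append) «ONE IS STABLE», STATICALLY, for the first-order model: a phase-cohesive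
synchronized state is a local minimum of the potential (transported from
`ClassicalModel.LosslessSystem.isLocalMin_potential_of_cohesive`; the other `2ᴺ⁻¹ − 1` pinned
synchronized states of a tree are unstable synchronized solutions, §3) -/

namespace NonuniformKuramoto

variable {n : ℕ} (K : NonuniformKuramoto n)

/-- **A phase-cohesive synchronized state is a local minimum of the potential** (`φ = 0`,
`Dᵢ ≠ 0`, `P` symmetric): `field(θ) = 0` and `Pᵢⱼ cos(θᵢ − θⱼ) > 0` on every coupled pair (`i ≠ j`,
`Pᵢⱼ ≠ 0`) ⇒ `U(x) = −Σ ωᵢxᵢ − ½ΣΣ Pᵢⱼcos(xᵢ − xⱼ)` has a local minimum at `θ` (convexity of `U`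
along short segments; the network-reduced reading of the same data).
[cite: ManikTimmeWitthaut2017, §3 Lemma 1 (proof: «In normal operation … M is a Laplacian matrix»; «for both Kuramoto system and the power grid model») and §5.2 proof of Cor. 2] -/
theorem isLocalMin_potential_of_cohesive (hD : ∀ i, K.D i ≠ 0)
    (hP : ∀ i j, K.P i j = K.P j i) (hφ : ∀ i j, K.φ i j = 0)
    {θ : Fin n → ℝ} (hθ : ∀ i, K.field θ i = 0)
    (hcoh : ∀ i j, i ≠ j → K.P i j ≠ 0 → 0 < K.P i j * Real.cos (θ i - θ j)) :
    IsLocalMin (fun x : Fin n → ℝ =>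
      -(∑ i, K.ω i * x i) - 1 / 2 * ∑ i, ∑ j, K.P i j * Real.cos (x i - x j)) θ := by
  set L : ClassicalModel.LosslessSystem n 0 :=
    { M := K.D, D := K.D, P := K.ω, C := K.P, K := fun _ b => b.elim0, β := fun b => b.elim0 }
    with hL
  have hLU : L.potential = fun x : Fin n → ℝ =>
      -(∑ i, K.ω i * x i) - 1 / 2 * ∑ i, ∑ j, K.P i j * Real.cos (x i - x j) :=
    funext fun x => by rw [L.potential_eq_of_noBus]
  have hθL : L.IsEquilibrium θ := fun i => by
    show K.ω i = L.flow θ i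
    have : L.flow θ i = ∑ j, K.P i j * Real.sin (θ i - θ j) := by
      simp [ClassicalModel.LosslessSystem.flow, hL]
    rw [this, K.sum_sin_eq_of_field_eq_zero hD hφ hθ i]
  have h := L.isLocalMin_potential_of_cohesive hP hθL (fun i j hij hc => hcoh i j hij hc)
    (fun i b _ => b.elim0)
  rwa [hLU] at h

/-- **On a radial network the phase-cohesive synchronized state minimises the synchronous-frame
potential locally** (`φ = 0`, `Dᵢ > 0`, `P` symmetric and tree-supported): if
`field(θc) = ω_sync 𝟙` (`ω_sync = Σωₖ/ΣDₖ`) and `P_{i,p(i)} cos(θcᵢ − θc_{p(i)}) > 0` on every tree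
edge, then `Ũ(x) = −Σ(ωᵢ − Dᵢω_sync)xᵢ − ½ΣΣ Pᵢⱼcos(xᵢ − xⱼ)` has a local minimum at `θc` — the
«+»-pattern state of Cor. 2 (SPDB2013 Thm 2's synchronized solution) is the energy minimum among the
`2ᴺ⁻¹` synchronized states per period, every other one being an unstable synchronized solution
(`unstable_syncSolution_of_ne_cohesive_of_tree`). Its Lyapunov / exponential stability is NOT
re-proved here.
[cite: ManikTimmeWitthaut2017, §5.2 Cor. 2 and its proof; SimpsonPorcoDorflerBullo2013, §3 Thm 2; DorflerChertkovBullo2013, SI §3.2 Thm 2 (G1)] -/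
theorem isLocalMin_syncPotential_of_cohesive_of_tree (hD : ∀ i, 0 < K.D i)
    (hP : ∀ i j, K.P i j = K.P j i) (hφ : ∀ i j, K.φ i j = 0)
    {root : Fin n} {parent : Fin n → Fin n}
    (htree : ∀ i j, i ≠ j → K.P i j ≠ 0 → (i ≠ root ∧ j = parent i) ∨ (j ≠ root ∧ i = parent j))
    {θc : Fin n → ℝ} (hec : ∀ i, K.field θc i = (∑ j, K.ω j) / ∑ j, K.D j)
    (hcoh : ∀ i, i ≠ root → 0 < K.P i (parent i) * Real.cos (θc i - θc (parent i))) :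
    IsLocalMin (fun x : Fin n → ℝ =>
      -(∑ i, (K.ω i - K.D i * ((∑ j, K.ω j) / ∑ j, K.D j)) * x i)
        - 1 / 2 * ∑ i, ∑ j, K.P i j * Real.cos (x i - x j)) θc := by
  set c := (∑ j, K.ω j) / ∑ j, K.D j with hc
  set Kc : NonuniformKuramoto n := { K with ω := fun j => K.ω j - K.D j * c } with hKc
  have hD0 : ∀ i, K.D i ≠ 0 := fun i => (hD i).ne'
  have hDc : ∀ i, Kc.D i ≠ 0 := hD0
  have hPc : ∀ i j, Kc.P i j = Kc.P j i := hP
  have hφc : ∀ i j, Kc.φ i j = 0 := hφ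
  have hθc : ∀ i, Kc.field θc i = 0 := fun i => by
    have h := K.field_rotatingFrame c hD0 θc i
    rw [hKc, h, hec i, hc, sub_self]
  refine Kc.isLocalMin_potential_of_cohesive hDc hPc hφc hθc fun i j hij hcP => ?_
  have hc' : K.P i j ≠ 0 := hcP
  show 0 < K.P i j * Real.cos (θc i - θc j)
  rcases htree i j hij hc' with ⟨hi, hj⟩ | ⟨hj, hi⟩
  · subst hj
    exact hcoh i hi
  · subst hi
    rw [hP (parent j) j, ← Real.cos_neg, neg_sub]
    exact hcoh j hj

end NonuniformKuramoto

end Literature.MathematicalPhysics.PowerSystems
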